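import Literature.MathematicalPhysics.QuantumFieldTheory.TwistedPartitionFunctionStrongCouplingRatchet
import Literature.MathematicalPhysics.QuantumFieldTheory.WilsonFinTorusTwistedPartitionSwap
import HarnessLib

/-!
# All three TEMPORAL planes of the anisotropic box `L_s³ × L_t`: the twisted partition functions agree, and the `L_t`-uniform
# strong-coupling doublings hold for `(0,3)`, `(1,3)`, `(2,3)` alike

Topic `Literature/MathematicalPhysics/QuantumFieldTheory`; bookkeeping sequel of `AnisotropicTemporalTwistSpatialDoubling.lean` and
`TwistedPartitionFunctionStrongCouplingRatchet.lean` (plane `(0,3)`), using the relabellings of the three SPATIAL axes of the `Fin`-box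
(`WilsonFinTorusTwistedPartitionSwap.lean`: `wilsonFinTorusTwistedPartition_swap01/02`) and `twistedPartitionFunctionAniso_temporal`.

* ★ `twistedPartitionFunctionAniso_temporal_eq_03` — for every temporal plane `q = (μ, 3)`:
  `Z_β(z; q; L_s, L_t) = Z_β(z; (0,3); L_s, L_t)` (continuous `ρ`, any `z`, `β`, `L_s`, `L_t`);
* ★★ `exists_beta0_twistedPartitionFunctionAniso_temporal_doublings` — unitary continuous `ρ` (`N ≥ 1`), central `z` with `ρ(z) = ω·1`,
  `|ω| = 1`, `ω ≠ 1`: `∃ β₀ > 0, ∀ 0 < β ≤ β₀, ∀ temporal q, ∀ a, ∀ b ≥ 1`: BOTH `t_z(q; 2^{b+1}, 2^{a+1}) ≤ t_z(q; 2^{b+2}, 2^{a+1})` (spatial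
  doubling, uniform in `L_t`) AND `t_z(q; 2^{b+1}, 2^{a+1}) ≤ t_z(q; 2^{b+1}, 2^{a+2})` (time doubling, uniform in `L_s`).

HONEST FRAMING: strong coupling only; temporal planes only (a spatial plane `(i, j)`, `i < j < 3`, would need a magnetic-flux floor that is
not in the tree); scalar centre action only.

References: G. 't Hooft, Nucl. Phys. B153 (1979) 141 [tHooft1979Flux] §2, §5; E. T. Tomboulis, L. G. Yaffe, Commun. Math. Phys. 100 (1985) 313
[TomboulisYaffe1985] App. I.
-/

noncomputable section

open MeasureTheory
open scoped BigOperators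

namespace Literature.MathematicalPhysics.QuantumFieldTheory

variable {G : Type*} [Group G] [TopologicalSpace G] [IsTopologicalGroup G] [CompactSpace G] [MeasurableSpace G] [BorelSpace G]
  {N : ℕ} (ρ : G →* Matrix (Fin N) (Fin N) ℂ)

/-- **★ The three temporal planes of `L_s³ × L_t` carry the same twisted partition function**: for `q = (μ, 3)`,
`Z_β(z; q; L_s, L_t) = Z_β(z; (0,3); L_s, L_t)` — the twist family `Pi.mulSingle μ z` is carried to `Pi.mulSingle 0 z` by the relabelling
`0 ↔ μ` of the spatial axes, which preserves the box `L_s³ × L_t`. [cite: tHooft1979Flux, §2 (2.5)–(2.6)] -/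
theorem twistedPartitionFunctionAniso_temporal_eq_03 (hρ : Continuous ρ) (β : ℝ) (Ls Lt : ℕ) (z : G)
    (q : {p : Fin 4 × Fin 4 // p.1 < p.2}) (hq : q.1.2 = 3) :
    twistedPartitionFunctionAniso ρ β Ls Lt z q = twistedPartitionFunctionAniso ρ β Ls Lt z ⟨((0 : Fin 4), (3 : Fin 4)), by decide⟩ := by
  rw [twistedPartitionFunctionAniso_temporal ρ β Ls Lt z q hq,
    twistedPartitionFunctionAniso_temporal ρ β Ls Lt z ⟨((0 : Fin 4), (3 : Fin 4)), by decide⟩ rfl]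
  have hμ : q.1.1 = 0 ∨ q.1.1 = 1 ∨ q.1.1 = 2 := by
    have h := q.2
    rw [hq] at h
    revert h
    generalize q.1.1 = μ
    decide +revert
  rcases hμ with h | h | h
  · rw [h]
  · rw [h, wilsonFinTorusTwistedPartition_swap01 ρ hρ β (Pi.mulSingle (1 : Fin 4) z)]
    congr 1
    funext i
    fin_cases i <;> simp [Equiv.swap_apply_of_ne_of_ne]
  · rw [h, wilsonFinTorusTwistedPartition_swap02 ρ hρ β (Pi.mulSingle (2 : Fin 4) z)]
    congr 1
    funext i
    fin_cases i <;> simp [Equiv.swap_apply_of_ne_of_ne]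

variable [SecondCountableTopology G]

/-- **★★ Both one-directional doublings, every temporal plane, at strong coupling** (packaged with the explicit threshold of
`exists_beta0_twistedPartitionFunctionAniso_03_ratio_le_spatial_double`).  Unitary continuous `ρ` (`N ≥ 1`), central `z` with `ρ(z) = ω·1`,
`|ω| = 1`, `ω ≠ 1`: `∃ β₀ > 0, ∀ 0 < β ≤ β₀, ∀ q = (μ,3), ∀ a, ∀ b ≥ 1`:
`t_z(q; 2^{b+1}, 2^{a+1}) ≤ t_z(q; 2^{b+2}, 2^{a+1})` and `t_z(q; 2^{b+1}, 2^{a+1}) ≤ t_z(q; 2^{b+1}, 2^{a+2})`.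
[cite: TomboulisYaffe1985, App. I and §2 eqs. (2.10)–(2.12)] [cite: tHooft1979Flux, §5] -/
theorem exists_beta0_twistedPartitionFunctionAniso_temporal_doublings (hρu : ∀ g, ρ g ∈ Matrix.unitaryGroup (Fin N) ℂ)
    (hρ : Continuous ρ) (hN : 1 ≤ N) {z : G} (hz : z ∈ Subgroup.center G) {ω : ℂ}
    (hω : ρ z = ω • (1 : Matrix (Fin N) (Fin N) ℂ)) (hω1 : ‖ω‖ = 1) (hne : ω ≠ 1) :
    ∃ β₀ : ℝ, 0 < β₀ ∧ ∀ β : ℝ, 0 < β → β ≤ β₀ → ∀ q : {p : Fin 4 × Fin 4 // p.1 < p.2}, q.1.2 = 3 → ∀ a b : ℕ, 1 ≤ b →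
      (twistedPartitionFunctionAniso ρ β (2 ^ (b + 1)) (2 ^ (a + 1)) z q / twistedPartitionFunctionAniso ρ β (2 ^ (b + 1)) (2 ^ (a + 1)) 1 q ≤
          twistedPartitionFunctionAniso ρ β (2 ^ (b + 2)) (2 ^ (a + 1)) z q /
            twistedPartitionFunctionAniso ρ β (2 ^ (b + 2)) (2 ^ (a + 1)) 1 q) ∧
      (twistedPartitionFunctionAniso ρ β (2 ^ (b + 1)) (2 ^ (a + 1)) z q / twistedPartitionFunctionAniso ρ β (2 ^ (b + 1)) (2 ^ (a + 1)) 1 q ≤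
          twistedPartitionFunctionAniso ρ β (2 ^ (b + 1)) (2 ^ (a + 2)) z q /
            twistedPartitionFunctionAniso ρ β (2 ^ (b + 1)) (2 ^ (a + 2)) 1 q) := by
  set v : ℝ := ∫ g, (max ((ρ g).trace.re) 0) ^ 2 ∂haarProbability G with hv
  have hv0 : 0 < v := integral_pos_part_sq_trace_re_pos ρ hρ hN
  have hNpos : (0 : ℝ) < N := by exact_mod_cast hN
  have hδ0 : 0 < ‖1 - ω‖ ^ 2 := by
    have : ‖1 - ω‖ ≠ 0 := fun h => hne (by rw [norm_eq_zero, sub_eq_zero] at h; exact h.symm)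
    positivity
  set K : ℝ := 4 * ((97 : ℝ) ^ 2 * Real.exp 2) with hK
  have hK0 : 0 < K := by positivity
  refine ⟨min (min 1 (4 / v)) (min (1 / (K * N)) (v / 768 * ‖1 - ω‖ ^ 2 / (12288 * (4 * (97 : ℝ) ^ 2 * Real.exp 1) ^ 2 * (N : ℝ) ^ 4))),
    by positivity, fun β hβ0 hβ q hq a b hb => ?_⟩
  have hβ1 : β ≤ 1 := hβ.trans ((min_le_left _ _).trans (min_le_left _ _))
  have hβv : β * v ≤ 4 := by
    have h : β ≤ 4 / v := hβ.trans ((min_le_left _ _).trans (min_le_right _ _))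
    exact (le_div_iff₀ hv0).1 h
  have hβK : (N : ℝ) * β ≤ 1 / K := by
    have h : β ≤ 1 / (K * N) := hβ.trans ((min_le_right _ _).trans (min_le_left _ _))
    rw [show 1 / (K * N) = 1 / K / (N : ℝ) by rw [div_div], le_div_iff₀ hNpos] at h
    linarith
  have hβδ : β ≤ v / 768 * ‖1 - ω‖ ^ 2 / (12288 * (4 * (97 : ℝ) ^ 2 * Real.exp 1) ^ 2 * (N : ℝ) ^ 4) :=
    hβ.trans ((min_le_right _ _).trans (min_le_right _ _))
  -- reduce to the plane `(0,3)`
  simp only [twistedPartitionFunctionAniso_temporal_eq_03 ρ hρ β _ _ _ q hq]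
  -- dyadic letters
  have ha1 : 1 ≤ 2 ^ a := Nat.one_le_two_pow
  have hb2 : 2 ^ 1 ≤ 2 ^ b := Nat.pow_le_pow_right (by norm_num) hb
  have hm : (2 ^ a - 1) + 1 = 2 ^ a := by omega
  have hn : (2 ^ b - 1) + 1 = 2 ^ b := by omega
  have hn1 : 1 ≤ 2 ^ b - 1 := by simp at hb2; omega
  have h1 : 2 ^ (b + 1) = 2 * (2 ^ b - 1) + 2 := by rw [pow_succ]; omega
  have h2 : 2 ^ (b + 2) = 2 * (2 * (2 ^ b - 1) + 2) := by rw [pow_succ, pow_succ]; omega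
  have h3 : 2 ^ (a + 1) = 2 * (2 ^ a - 1) + 2 := by rw [pow_succ]; omega
  have h4 : 2 ^ (a + 2) = 2 * (2 * (2 ^ a - 1) + 2) := by rw [pow_succ, pow_succ]; omega
  rw [h1, h2, h3, h4]
  exact ⟨twistedPartitionFunctionAniso_03_ratio_le_spatial_double ρ hρu hρ hN hz hω hω1 hne hm hn hn1 hβ0 hβ1 hβv hβK hβδ,
    twistedPartitionFunctionAniso_03_ratio_le_time_double ρ hρu hρ hN hz hω hω1 hne hm hn hn1 hβ0 hβ1 hβv hβK hβδ⟩

end Literature.MathematicalPhysics.QuantumFieldTheory
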